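import Literature.Analysis.FluidPDE.LagrangianLatticeCarrierFrameClamp
import HarnessLib

/-!
# The clamped Lagrangian frame delivers the test-side inputs of the distorted-frame pairing identity

Analysis/FluidPDE proof file (theorems only; no definitions, no named facts). Integration of the (δ)
package (`LagrangianLatticeCarrierFrameClamp`) with the frame-test admissibility file
(`PassiveVectorTensorDistortedFrameTest`): for a Lagrangian lattice carrier with `LevelRegular` data and
the flow property at level `m`, a refresh window `[w, w + T]` (`w = j·refresh(m+1)`, `0 < T < refresh(m+1)`)
and ANY profile `φ : ℝ → T³ → ℝ³` with smooth slices, jointly continuous space derivatives, bounded and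
time-Lipschitz on `[0,T]`, the clamped frame `J̃(t,y) = ∇X_m(w + clamp t, w)(y)` read as a
`Matrix (Fin 3) (Fin 3) ℝ`-valued field gives, in exactly the shapes consumed by
`Torus.IsWeakTensorPassiveVectorDistortedOn.ae_integral_inner_distort_frame_eq` (file
`PassiveVectorTensorDistortedFramePairing`, hypotheses `hΨs`, `hΨc`, `hΨL`, `hGJ`, `hJ'`):
* `isSmooth_distort_clampFrame` (hΨs), `continuous_uncurry_iterPartialDeriv_distort_clampFrame` (hΨc),
  `exists_lipschitz_distort_clampFrame` (hΨL), `adjugate_clampFrame_mul` (hGJ with `G̃ = adj J̃`),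
  `hasDerivAt_clampFrame_matrix` (hJ' for EVERY interior `t`, hence a.e. on `(0,T)`:
  `ae_hasDerivAt_clampFrame_matrix`).

## References

* S. Armstrong, V. Vicol, *Anomalous diffusion by fractal homogenization*, Ann. PDE 11 (2025),
  arXiv:2305.05048, §2.2, §4.1 (Lagrangian frames on refresh windows). [`ArmstrongVicol2025`]
* R. J. DiPerna, P.-L. Lions, Invent. Math. 98 (1989), §II.1 (admissible test functions). [`DiPernaLions1989Invent`]
-/

noncomputable section

open Set Filter Topology Function MeasureTheory
open scoped NNReal

namespace Literature.Analysis.FluidPDE.LatticeShear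

namespace LagrangianLatticeCarrier

open Literature.Analysis.FunctionSpaces Literature.Analysis.FunctionSpaces.Torus
open Literature.Analysis.ODE.TorusFlow Literature.Analysis.FluidPDE.Torus

variable {k : ℕ} {E : LagrangianLatticeCarrier k}

/-- **hΨs**: the distorted test `J̃(t)·φ(t)` is smooth for every `t`. [cite: ArmstrongVicol2025, §4.1] -/
theorem LevelRegular.isSmooth_distort_clampFrame (h : E.LevelRegular) (m : ℕ) (j : ℤ) (T : ℝ)
    {φ : ℝ → UnitAddTorus (Fin 3) → EuclideanSpace ℝ (Fin 3)} (hφs : ∀ t, IsSmooth (φ t)) (t : ℝ) :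
    IsSmooth (distort (fun y => Matrix.of fun a c => (E.flowDeriv m ((j : ℝ) * E.refresh (m + 1) + max 0 (min t T))
      ((j : ℝ) * E.refresh (m + 1)) y (EuclideanSpace.single c (1 : ℝ))) a) (φ t)) :=
  isSmooth_distort (fun a c => h.isSmooth_clampFrame_entry m j T t a c) (hφs t)

/-- **hΨc**: all space derivatives of `J̃(t)·φ(t)` are jointly continuous on `ℝ × T³`.
[cite: DiPernaLions1989Invent, §II.1] -/
theorem LevelRegular.continuous_uncurry_iterPartialDeriv_distort_clampFrame (h : E.LevelRegular) (m : ℕ) (j : ℤ)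
    {T : ℝ} (hT0 : 0 ≤ T) (hT : T < E.refresh (m + 1))
    {φ : ℝ → UnitAddTorus (Fin 3) → EuclideanSpace ℝ (Fin 3)} (hφs : ∀ t, IsSmooth (φ t))
    (hφc : ∀ l : List (Fin 3), Continuous (uncurry fun t y => iterPartialDeriv l (φ t) y)) (l : List (Fin 3)) :
    Continuous (uncurry fun t y => iterPartialDeriv l
      (distort (fun y => Matrix.of fun a c => (E.flowDeriv m ((j : ℝ) * E.refresh (m + 1) + max 0 (min t T))
        ((j : ℝ) * E.refresh (m + 1)) y (EuclideanSpace.single c (1 : ℝ))) a) (φ t)) y) :=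
  continuous_uncurry_iterPartialDeriv_distort
    (J := fun t y => Matrix.of fun a c => (E.flowDeriv m ((j : ℝ) * E.refresh (m + 1) + max 0 (min t T))
      ((j : ℝ) * E.refresh (m + 1)) y (EuclideanSpace.single c (1 : ℝ))) a)
    (fun t a c => h.isSmooth_clampFrame_entry m j T t a c) hφs
    (fun l a c => h.continuous_uncurry_iterPartialDeriv_clampFrame_entry m j hT0 hT l a c) hφc l

/-- **hΨL**: `J̃·φ` is time-Lipschitz on `[0,T]`, uniformly in space. [cite: ArmstrongVicol2025, §5.1] -/
theorem LevelRegular.exists_lipschitz_distort_clampFrame (h : E.LevelRegular) {m : ℕ} (hF : E.IsFlow m) (j : ℤ)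
    {T : ℝ} (hT0 : 0 ≤ T) (hT : T < E.refresh (m + 1))
    {φ : ℝ → UnitAddTorus (Fin 3) → EuclideanSpace ℝ (Fin 3)}
    (hφL : ∃ L : ℝ, ∀ t ∈ Icc 0 T, ∀ s ∈ Icc 0 T, ∀ y, ‖φ t y - φ s y‖ ≤ L * |t - s|)
    (hφb : ∃ B' : ℝ, ∀ t ∈ Icc 0 T, ∀ y, ‖φ t y‖ ≤ B') :
    ∃ L' : ℝ, 0 ≤ L' ∧ ∀ t ∈ Icc 0 T, ∀ s ∈ Icc 0 T, ∀ y,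
      ‖distort (fun y => Matrix.of fun a c => (E.flowDeriv m ((j : ℝ) * E.refresh (m + 1) + max 0 (min t T))
          ((j : ℝ) * E.refresh (m + 1)) y (EuclideanSpace.single c (1 : ℝ))) a) (φ t) y -
        distort (fun y => Matrix.of fun a c => (E.flowDeriv m ((j : ℝ) * E.refresh (m + 1) + max 0 (min s T))
          ((j : ℝ) * E.refresh (m + 1)) y (EuclideanSpace.single c (1 : ℝ))) a) (φ s) y‖ ≤ L' * |t - s| := by
  obtain ⟨B, hB⟩ := h.exists_bound_clampFrame_entry m j hT0 hT
  exact exists_lipschitz_distort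
    (J := fun t y => Matrix.of fun a c => (E.flowDeriv m ((j : ℝ) * E.refresh (m + 1) + max 0 (min t T))
      ((j : ℝ) * E.refresh (m + 1)) y (EuclideanSpace.single c (1 : ℝ))) a)
    (h.exists_lipschitz_clampFrame_entry hF j hT) ⟨B, fun t _ y a c => hB t y a c⟩ hφL hφb

/-- **hGJ** with `G̃ = adj J̃`: `adj J̃(t,y) · J̃(t,y) = 1` for every `t, y`. [cite: ArmstrongVicol2025, §4.1] -/
theorem LevelRegular.adjugate_clampFrame_mul (h : E.LevelRegular) {m : ℕ} (hF : E.IsFlow m) (j : ℤ)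
    {T : ℝ} (hT0 : 0 ≤ T) (hT : T < E.refresh (m + 1)) (t : ℝ) (y : UnitAddTorus (Fin 3)) :
    (fun t y => (Matrix.of fun a c => (E.flowDeriv m ((j : ℝ) * E.refresh (m + 1) + max 0 (min t T))
        ((j : ℝ) * E.refresh (m + 1)) y (EuclideanSpace.single c (1 : ℝ))) a).adjugate) t y *
      (fun t y => Matrix.of fun a c => (E.flowDeriv m ((j : ℝ) * E.refresh (m + 1) + max 0 (min t T))
        ((j : ℝ) * E.refresh (m + 1)) y (EuclideanSpace.single c (1 : ℝ))) a) t y = 1 :=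
  h.adjugate_mul_clampFrame hF j hT0 hT t y

/-- **hJ'** at every interior time, matrix-valued: `HasDerivAt (t ↦ J̃(t,y)) (∇b_{≤m}(w+t, X)·J̃(t,y)) t`
for `t ∈ (0,T)`. [cite: ArmstrongVicol2025, §5.1] -/
theorem LevelRegular.hasDerivAt_clampFrame_matrix (h : E.LevelRegular) {m : ℕ} (hF : E.IsFlow m) (j : ℤ)
    {T : ℝ} (hT : T < E.refresh (m + 1)) {t : ℝ} (ht : t ∈ Ioo 0 T) (y : UnitAddTorus (Fin 3)) :
    HasDerivAt
      (fun s => (Matrix.of fun a c => (E.flowDeriv m ((j : ℝ) * E.refresh (m + 1) + max 0 (min s T))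
        ((j : ℝ) * E.refresh (m + 1)) y (EuclideanSpace.single c (1 : ℝ))) a : Matrix (Fin 3) (Fin 3) ℝ))
      ((Matrix.of fun a i => FunctionSpaces.Torus.partialDeriv i (fun z => E.partialSum m ((j : ℝ) * E.refresh (m + 1) + t) z a)
          (E.X m ((j : ℝ) * E.refresh (m + 1) + t) ((j : ℝ) * E.refresh (m + 1)) y)) *
        (Matrix.of fun a c => (E.flowDeriv m ((j : ℝ) * E.refresh (m + 1) + t) ((j : ℝ) * E.refresh (m + 1)) y
          (EuclideanSpace.single c (1 : ℝ))) a)) t :=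
  hasDerivAt_pi.2 fun a => hasDerivAt_pi.2 fun c =>
    (hasDerivAt_pi.1 ((hasDerivAt_pi.1 (h.hasDerivAt_clampFrame hF j hT ht y)) a)) c

/-- **hJ'** in the almost-everywhere form on `(0,T)`. [cite: DiPernaLions1989Invent, §II.1] -/
theorem LevelRegular.ae_hasDerivAt_clampFrame_matrix (h : E.LevelRegular) {m : ℕ} (hF : E.IsFlow m) (j : ℤ)
    {T : ℝ} (hT : T < E.refresh (m + 1)) :
    ∀ᵐ t ∂(volume.restrict (Ioo 0 T)), ∀ y : UnitAddTorus (Fin 3), HasDerivAt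
      (fun s => (Matrix.of fun a c => (E.flowDeriv m ((j : ℝ) * E.refresh (m + 1) + max 0 (min s T))
        ((j : ℝ) * E.refresh (m + 1)) y (EuclideanSpace.single c (1 : ℝ))) a : Matrix (Fin 3) (Fin 3) ℝ))
      ((Matrix.of fun a i => FunctionSpaces.Torus.partialDeriv i (fun z => E.partialSum m ((j : ℝ) * E.refresh (m + 1) + t) z a)
          (E.X m ((j : ℝ) * E.refresh (m + 1) + t) ((j : ℝ) * E.refresh (m + 1)) y)) *
        (Matrix.of fun a c => (E.flowDeriv m ((j : ℝ) * E.refresh (m + 1) + t) ((j : ℝ) * E.refresh (m + 1)) y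
          (EuclideanSpace.single c (1 : ℝ))) a)) t := by
  rw [ae_restrict_iff' measurableSet_Ioo]
  exact Filter.Eventually.of_forall fun t ht y => h.hasDerivAt_clampFrame_matrix hF j hT ht y

end LagrangianLatticeCarrier

end Literature.Analysis.FluidPDE.LatticeShear

end
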